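import Summits.CriticalPhenomena.Ising3DConformalLimit.Theses.HyperoctahedralRP
import Literature.Probability.LatticeModels.CriticalWickDichotomy
import Literature.Barriers.CriticalPhenomena.ScaleCovarianceNotMoebius

/-!
# Drefute evidence for line `inversion-defect-involution` (crux `InversionUpgradeNormalised`,
stmt-CriticalPhenomena-1982)

Refuter `refuter-drefute-stmt-CriticalPhenomena-1982-0`.  The four stub STATEMENTS of the
skeleton `Lines/inversion-defect-involution.lean` are copied verbatim (`latticeRatio`,
`limitRatio`, `EvenPositivity`, `RatioTransfer`, `LatticeOneSidedFour`, `LatticeOneSidedHigher`)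
and the following is PROVED (sorry-free):

* `evenPositivity : EvenPositivity` — stub A holds (GKS II split `G_{m+2} ≥ G_m · G_2` for the
  plus state at `β_c`, passed to the pointwise limit; `S₀ = 1`).  Candidate proof for the lead.
* `ratioTransfer : RatioTransfer` — stub B holds (the weight-free lattice ratio converges to the
  limit ratio, `tendsto_latticeRatio`; limits of inequalities).  Candidate proof for the lead.
* `latticeOneSidedFour_of_crux`, `latticeOneSidedHigher_of_crux` — stubs C and D are IMPLIED BY
  THE CRUX (they are necessary, not merely sufficient): with the skeleton's composition
  `A → B → C → D → crux` this certifies that `{C, D}` is an EXACT decomposition of the crux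
  (`crux ↔ C ∧ D` over the theorems A, B).  Consequence for drefute: no stub of this line can be
  false unless the crux itself is false; C/D cannot be attacked below crux level.
* `lattice_oneSided_iff_limitRatio_le` — for every instance of the crux's data, the lattice
  `ε`-inequality of C/D at `x` is EQUIVALENT to `R_S(x) ≤ R_S(ιx)` for the limit: the lattice
  costume carries no slack beyond the continuum ratio inequality.
* `lattice_twoSided_of_crux` — the ball restriction `‖xᵢ‖ < 1` and `4 ≤ n` are idle for necessity
  (the crux gives both one-sided inequalities at every even `n`, every `x` avoiding `0`).

All declarations: `lean check` rc 0, no warnings, axioms `propext, Classical.choice, Quot.sound`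
(in particular the GKS / box-limit facts feeding A are fully proved in the tree — no `sorryAx`).
-/

noncomputable section

open Filter Topology
open Literature.Probability.LatticeModels EuclideanGeometry

namespace Summit.CriticalPhenomena.Ising3DConformalLimit.Cruxes.InversionUpgradeNormalised.Drefute

/-! ### Verbatim copies of the skeleton's vocabulary and stub statements -/

/-- Skeleton's `latticeRatio` (verbatim). [folklore] -/
def latticeRatio (n : ℕ) (δ : ℝ) (x : Fin (n + 2) → EuclideanSpace ℝ (Fin 3)) : ℝ :=
  rescaledCorrelator (criticalCorr 3) 1 n δ (fun i => x (Fin.castAdd 2 i)) *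
      rescaledCorrelator (criticalCorr 3) 1 2 δ (fun i => x (Fin.natAdd n i)) /
    rescaledCorrelator (criticalCorr 3) 1 (n + 2) δ x

/-- Skeleton's `limitRatio` (verbatim). [folklore] -/
def limitRatio (S : CorrFamily 3) (n : ℕ) (x : Fin (n + 2) → EuclideanSpace ℝ (Fin 3)) : ℝ :=
  S n (fun i => x (Fin.castAdd 2 i)) * S 2 (fun i => x (Fin.natAdd n i)) / S (n + 2) x

/-- Stub A statement (verbatim). [folklore] -/
def EvenPositivity : Prop :=
  ∀ (ρ : ℝ → ℝ) (S : CorrFamily 3), (∀ δ ∈ Set.Ioc (0:ℝ) 1, 0 < ρ δ) →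
    HasPointwiseScalingLimit (criticalCorr 3) ρ S → IsNondegenerateTwoPoint S →
    ∀ n : ℕ, Even n → ∀ x ∈ NonCoincident 3 n, 0 < S n x

/-- Stub B statement (verbatim). [folklore] -/
def RatioTransfer : Prop :=
  ∀ (ρ : ℝ → ℝ) (S : CorrFamily 3), (∀ δ ∈ Set.Ioc (0:ℝ) 1, 0 < ρ δ) →
    HasPointwiseScalingLimit (criticalCorr 3) ρ S →
    ∀ (n : ℕ) (x y : Fin (n + 2) → EuclideanSpace ℝ (Fin 3)),
      x ∈ NonCoincident 3 (n + 2) → y ∈ NonCoincident 3 (n + 2) →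
      S (n + 2) x ≠ 0 → S (n + 2) y ≠ 0 →
      (∀ ε : ℝ, 0 < ε → ∀ᶠ δ in 𝓝[>] (0:ℝ), latticeRatio n δ x ≤ latticeRatio n δ y + ε) →
      limitRatio S n x ≤ limitRatio S n y

/-- Stub C statement (verbatim). [folklore] -/
def LatticeOneSidedFour : Prop :=
  ∀ (ρ : ℝ → ℝ) (Δ : ℝ) (S : CorrFamily 3), (∀ δ ∈ Set.Ioc (0:ℝ) 1, 0 < ρ δ) →
    HasPointwiseScalingLimit (criticalCorr 3) ρ S →
    (∀ n z, z ∉ NonCoincident 3 n → S n z = 0) → IsNondegenerateTwoPoint S →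
    IsEuclideanInvariant S → IsScaleCovariant Δ S →
    ∀ x : Fin (2 + 2) → EuclideanSpace ℝ (Fin 3), x ∈ NonCoincident 3 (2 + 2) →
      (∀ i, x i ≠ 0) → (∀ i, ‖x i‖ < 1) →
      ∀ ε : ℝ, 0 < ε → ∀ᶠ δ in 𝓝[>] (0:ℝ),
        latticeRatio 2 δ x ≤ latticeRatio 2 δ (fun i => inversion 0 1 (x i)) + ε

/-- Stub D statement (verbatim). [folklore] -/
def LatticeOneSidedHigher : Prop :=
  ∀ (ρ : ℝ → ℝ) (Δ : ℝ) (S : CorrFamily 3), (∀ δ ∈ Set.Ioc (0:ℝ) 1, 0 < ρ δ) →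
    HasPointwiseScalingLimit (criticalCorr 3) ρ S →
    (∀ n z, z ∉ NonCoincident 3 n → S n z = 0) → IsNondegenerateTwoPoint S →
    IsEuclideanInvariant S → IsScaleCovariant Δ S →
    ∀ n : ℕ, Even n → 4 ≤ n →
      ∀ x : Fin (n + 2) → EuclideanSpace ℝ (Fin 3), x ∈ NonCoincident 3 (n + 2) →
        (∀ i, x i ≠ 0) → (∀ i, ‖x i‖ < 1) →
        ∀ ε : ℝ, 0 < ε → ∀ᶠ δ in 𝓝[>] (0:ℝ),
          latticeRatio n δ x ≤ latticeRatio n δ (fun i => inversion 0 1 (x i)) + ε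

/-- The crux, by name. [folklore] -/
abbrev Crux : Prop :=
  Summit.CriticalPhenomena.Ising3DConformalLimit.Theses.HyperoctahedralRP.InversionUpgradeNormalised

/-! ### Stub B: the weight-free ratio converges (pure filter algebra) -/

/-- `R^δ_n(x) → R_S(x)` as `δ → 0⁺` at a non-coincident `x` with `S_{n+2}(x) ≠ 0`: the `ρ`'s
cancel (`ρ δ ≠ 0` on `(0,1]`) and the three rescaled correlators converge pointwise. [folklore] -/
theorem tendsto_latticeRatio {ρ : ℝ → ℝ} {S : CorrFamily 3}
    (hρ : ∀ δ ∈ Set.Ioc (0:ℝ) 1, 0 < ρ δ)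
    (hlim : HasPointwiseScalingLimit (criticalCorr 3) ρ S)
    {n : ℕ} {x : Fin (n + 2) → EuclideanSpace ℝ (Fin 3)}
    (hx : x ∈ NonCoincident 3 (n + 2)) (hS : S (n + 2) x ≠ 0) :
    Tendsto (fun δ => latticeRatio n δ x) (𝓝[>] (0:ℝ)) (𝓝 (limitRatio S n x)) := by
  have hinj : Function.Injective x := hx
  have hx' : (fun i => x (Fin.castAdd 2 i)) ∈ NonCoincident 3 n :=
    hinj.comp (Fin.castAdd_injective n 2)
  have hx'' : (fun i => x (Fin.natAdd n i)) ∈ NonCoincident 3 2 :=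
    hinj.comp (Fin.natAdd_injective 2 n)
  have h1 := (hlim n).tendsto_at hx'
  have h2 := (hlim 2).tendsto_at hx''
  have h3 := (hlim (n + 2)).tendsto_at hx
  have hT := (h1.mul h2).div h3 hS
  refine hT.congr' ?_
  filter_upwards [Ioc_mem_nhdsGT zero_lt_one] with δ hδ
  have hρδ : ρ δ ≠ 0 := (hρ δ hδ).ne'
  simp only [Pi.div_apply, latticeRatio, rescaledCorrelator_apply, Pi.one_apply, one_pow, one_mul]
  rw [show ρ δ ^ n * criticalCorr 3 n (fun i => latticeApprox δ (x (Fin.castAdd 2 i))) *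
        (ρ δ ^ 2 * criticalCorr 3 2 (fun i => latticeApprox δ (x (Fin.natAdd n i)))) =
      ρ δ ^ (n + 2) * (criticalCorr 3 n (fun i => latticeApprox δ (x (Fin.castAdd 2 i))) *
        criticalCorr 3 2 (fun i => latticeApprox δ (x (Fin.natAdd n i)))) by ring]
  rw [mul_div_mul_left _ _ (pow_ne_zero _ hρδ)]

/-- **Stub B holds.** [folklore] -/
theorem ratioTransfer : RatioTransfer := by
  intro ρ S hρ hlim n x y hx hy hSx hSy hev
  have t1 := tendsto_latticeRatio hρ hlim hx hSx
  have t2 := tendsto_latticeRatio hρ hlim hy hSy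
  refine le_of_forall_pos_lt_add fun ε hε => ?_
  have hle : limitRatio S n x ≤ limitRatio S n y + ε / 2 :=
    le_of_tendsto_of_tendsto t1 (t2.add_const (ε / 2)) (hev (ε / 2) (by linarith))
  linarith

/-! ### Stub A: even orders of the limit are positive (GKS II in the limit) -/

/-- `⟨1⟩⁺_{β_c} = 1`: the empty spin monomial. [folklore] -/
theorem criticalCorr_fin_zero (y : Fin 0 → Site 3) : criticalCorr 3 0 y = 1 := by
  have hy : spinMonomial y = fun _ => (1:ℝ) := by
    funext s; simp [spinMonomial]
  show plusExpect 3 (criticalBeta 3) 0 (spinMonomial y) = 1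
  rw [hy]
  show limUnder atTop
      (fun L : ℕ => isingExpect (zdGraph 3) (box 3 L) (criticalBeta 3) 0 .plus (fun _ => (1:ℝ))) = 1
  simp_rw [isingExpect_const]
  exact tendsto_const_nhds.limUnder_eq

/-- Any pointwise limit of the critical correlators has `S 0 ≡ 1`. [folklore] -/
theorem limit_zero_eq_one {ρ : ℝ → ℝ} {S : CorrFamily 3}
    (hlim : HasPointwiseScalingLimit (criticalCorr 3) ρ S) (x : Fin 0 → EuclideanSpace ℝ (Fin 3)) :
    S 0 x = 1 := by
  have hx : x ∈ NonCoincident 3 0 := by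
    rw [mem_nonCoincident]; intro i; exact Fin.elim0 i
  have h := (hlim 0).tendsto_at hx
  have h1 : Tendsto (fun δ => rescaledCorrelator (criticalCorr 3) ρ 0 δ x) (𝓝[>] (0:ℝ)) (𝓝 1) := by
    refine tendsto_const_nhds.congr fun δ => ?_
    rw [rescaledCorrelator_apply, pow_zero, one_mul, criticalCorr_fin_zero]
  exact tendsto_nhds_unique h h1

/-- GKS II split for the critical plus state with multiplicities:
`⟨∏_{i<m} σ_{yᵢ}⟩ · ⟨σ_{y_m} σ_{y_{m+1}}⟩ ≤ ⟨∏_{i<m+2} σ_{yᵢ}⟩` at `β_c` on `ℤ³`. [cite: FriedliVelenik2017, Thm. 3.20, eq. (3.22), p. 109] -/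
theorem criticalCorr_mul_two_le (m : ℕ) (y : Fin (m + 2) → Site 3) :
    criticalCorr 3 m (fun i => y (Fin.castAdd 2 i)) * criticalCorr 3 2 (fun i => y (Fin.natAdd m i)) ≤
      criticalCorr 3 (m + 2) y := by
  classical
  obtain ⟨A, hA⟩ := exists_spinMonomial_eq_spinProduct (fun i => y (Fin.castAdd 2 i))
  obtain ⟨B, hB⟩ := exists_spinMonomial_eq_spinProduct (fun i => y (Fin.natAdd m i))
  have hy : spinMonomial y = spinProduct (symmDiff A B) := by
    funext s
    have h1 : spinMonomial y s = spinMonomial (fun i => y (Fin.castAdd 2 i)) s *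
        spinMonomial (fun i => y (Fin.natAdd m i)) s := by
      simp only [spinMonomial]
      exact Fin.prod_univ_add (fun i => spinAt (y i) s)
    rw [h1, hA, hB, spinProduct_mul_spinProduct]
  show plusExpect 3 (criticalBeta 3) 0 (spinMonomial fun i => y (Fin.castAdd 2 i)) *
      plusExpect 3 (criticalBeta 3) 0 (spinMonomial fun i => y (Fin.natAdd m i)) ≤
    plusExpect 3 (criticalBeta 3) 0 (spinMonomial y)
  rw [hA, hB, hy]
  exact plusCorr_mul_le (criticalBeta_nonneg 3) le_rfl A B

/-- **Stub A holds.** [folklore] -/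
theorem evenPositivity : EvenPositivity := by
  intro ρ S hρ hlim hnd n
  induction n using Nat.strong_induction_on with
  | _ n ih =>
    intro hn x hx
    rcases Nat.lt_or_ge n 2 with hlt | hge
    · interval_cases n
      · rw [limit_zero_eq_one hlim x]; exact one_pos
      · exact absurd hn (by decide)
    · obtain ⟨m, rfl⟩ := Nat.exists_eq_add_of_le' hge
      have hm : Even m := by
        rcases hn with ⟨k, hk⟩
        exact ⟨k - 1, by omega⟩
      have hinj : Function.Injective x := hx
      have hx' : (fun i => x (Fin.castAdd 2 i)) ∈ NonCoincident 3 m :=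
        hinj.comp (Fin.castAdd_injective m 2)
      have hx'' : (fun i => x (Fin.natAdd m i)) ∈ NonCoincident 3 2 :=
        hinj.comp (Fin.natAdd_injective 2 m)
      have hB : 0 < S m (fun i => x (Fin.castAdd 2 i)) := ih m (by omega) hm _ hx'
      have hC : 0 < S 2 (fun i => x (Fin.natAdd m i)) := hnd _ hx''
      have h1 := (hlim m).tendsto_at hx'
      have h2 := (hlim 2).tendsto_at hx''
      have h3 := (hlim (m + 2)).tendsto_at hx
      have hle : S m (fun i => x (Fin.castAdd 2 i)) * S 2 (fun i => x (Fin.natAdd m i)) ≤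
          S (m + 2) x := by
        refine le_of_tendsto_of_tendsto (h1.mul h2) h3 ?_
        filter_upwards [Ioc_mem_nhdsGT zero_lt_one] with δ hδ
        simp only [rescaledCorrelator_apply]
        have hρ0 : 0 ≤ ρ δ ^ (m + 2) := pow_nonneg (hρ δ hδ).le _
        calc ρ δ ^ m * criticalCorr 3 m (fun i => latticeApprox δ (x (Fin.castAdd 2 i))) *
              (ρ δ ^ 2 * criticalCorr 3 2 (fun i => latticeApprox δ (x (Fin.natAdd m i))))
            = ρ δ ^ (m + 2) * (criticalCorr 3 m (fun i => latticeApprox δ (x (Fin.castAdd 2 i))) *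
                criticalCorr 3 2 (fun i => latticeApprox δ (x (Fin.natAdd m i)))) := by ring
          _ ≤ ρ δ ^ (m + 2) * criticalCorr 3 (m + 2) (fun i => latticeApprox δ (x i)) :=
              mul_le_mul_of_nonneg_left (criticalCorr_mul_two_le m (fun i => latticeApprox δ (x i))) hρ0
      exact lt_of_lt_of_le (mul_pos hB hC) hle

/-! ### Stubs C and D are NECESSARY: the crux implies them -/

/-- For an inversion-covariant family the limit ratio is inversion INVARIANT (the weights cancel,
`Fin.prod_univ_add`). [folklore] -/
theorem limitRatio_inversion {Δ : ℝ} {S : CorrFamily 3} (hinv : IsInversionCovariant Δ S)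
    {n : ℕ} {x : Fin (n + 2) → EuclideanSpace ℝ (Fin 3)} (hx0 : ∀ i, x i ≠ 0) :
    limitRatio S n (fun i => inversion 0 1 (x i)) = limitRatio S n x := by
  simp only [limitRatio]
  rw [hinv (n + 2) x hx0]
  have h1 : S n (fun i => inversion 0 1 (x (Fin.castAdd 2 i))) =
      (∏ i : Fin n, ‖x (Fin.castAdd 2 i)‖ ^ (2 * Δ)) * S n (fun i => x (Fin.castAdd 2 i)) :=
    hinv n _ (fun i => hx0 _)
  have h2 : S 2 (fun i => inversion 0 1 (x (Fin.natAdd n i))) =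
      (∏ i : Fin 2, ‖x (Fin.natAdd n i)‖ ^ (2 * Δ)) * S 2 (fun i => x (Fin.natAdd n i)) :=
    hinv 2 _ (fun i => hx0 _)
  rw [h1, h2]
  have hw : (∏ i, ‖x i‖ ^ (2 * Δ)) =
      (∏ i : Fin n, ‖x (Fin.castAdd 2 i)‖ ^ (2 * Δ)) * ∏ i : Fin 2, ‖x (Fin.natAdd n i)‖ ^ (2 * Δ) :=
    Fin.prod_univ_add _
  rw [hw]
  have hw1 : 0 < ∏ i : Fin n, ‖x (Fin.castAdd 2 i)‖ ^ (2 * Δ) :=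
    Finset.prod_pos fun i _ => Real.rpow_pos_of_pos (norm_pos_iff.mpr (hx0 _)) _
  have hw2 : 0 < ∏ i : Fin 2, ‖x (Fin.natAdd n i)‖ ^ (2 * Δ) :=
    Finset.prod_pos fun i _ => Real.rpow_pos_of_pos (norm_pos_iff.mpr (hx0 _)) _
  set w1 := ∏ i : Fin n, ‖x (Fin.castAdd 2 i)‖ ^ (2 * Δ)
  set w2 := ∏ i : Fin 2, ‖x (Fin.natAdd n i)‖ ^ (2 * Δ)
  rw [show w1 * S n (fun i => x (Fin.castAdd 2 i)) * (w2 * S 2 (fun i => x (Fin.natAdd n i))) =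
      (w1 * w2) * (S n (fun i => x (Fin.castAdd 2 i)) * S 2 (fun i => x (Fin.natAdd n i))) by ring]
  rw [mul_div_mul_left _ _ (mul_pos hw1 hw2).ne']

/-- Core of the necessity: under the crux's hypotheses on `(ρ, Δ, S)` and inversion covariance
of `S`, the lattice one-sided inequality holds at every even `n` with slack `ε`. [folklore] -/
theorem lattice_oneSided_of_inversionCovariant {ρ : ℝ → ℝ} {Δ : ℝ} {S : CorrFamily 3}
    (hρ : ∀ δ ∈ Set.Ioc (0:ℝ) 1, 0 < ρ δ)
    (hlim : HasPointwiseScalingLimit (criticalCorr 3) ρ S) (hnd : IsNondegenerateTwoPoint S)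
    (hinv : IsInversionCovariant Δ S) {n : ℕ} (hn : Even n)
    {x : Fin (n + 2) → EuclideanSpace ℝ (Fin 3)} (hx : x ∈ NonCoincident 3 (n + 2))
    (hx0 : ∀ i, x i ≠ 0) {ε : ℝ} (hε : 0 < ε) :
    ∀ᶠ δ in 𝓝[>] (0:ℝ), latticeRatio n δ x ≤ latticeRatio n δ (fun i => inversion 0 1 (x i)) + ε := by
  have hpos := evenPositivity ρ S hρ hlim hnd
  have hn2 : Even (n + 2) := hn.add even_two
  have hxι : (fun i => inversion (0 : EuclideanSpace ℝ (Fin 3)) 1 (x i)) ∈ NonCoincident 3 (n + 2) :=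
    (inversion_injective (0 : EuclideanSpace ℝ (Fin 3)) one_ne_zero).comp hx
  have hSx : S (n + 2) x ≠ 0 := (hpos (n + 2) hn2 x hx).ne'
  have hSxι : S (n + 2) (fun i => inversion 0 1 (x i)) ≠ 0 := (hpos (n + 2) hn2 _ hxι).ne'
  have t1 := tendsto_latticeRatio hρ hlim hx hSx
  have t2 := tendsto_latticeRatio hρ hlim hxι hSxι
  rw [limitRatio_inversion hinv hx0] at t2
  have t3 : Tendsto (fun δ => latticeRatio n δ (fun i => inversion 0 1 (x i)) + ε - latticeRatio n δ x)
      (𝓝[>] (0:ℝ)) (𝓝 (limitRatio S n x + ε - limitRatio S n x)) := (t2.add_const ε).sub t1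
  have hgap : 0 < limitRatio S n x + ε - limitRatio S n x := by linarith
  filter_upwards [t3.eventually (lt_mem_nhds hgap)] with δ hδ
  linarith

/-- **Exact equivalence at the limit level.**  For every instance of the crux's data with positive
even orders (a theorem, `evenPositivity`), the lattice one-sided `ε`-inequality of stubs C/D at `x`
is EQUIVALENT to the continuum ratio inequality `R_S(x) ≤ R_S(ιx)`: the lattice costume carries no
slack beyond the limit statement (⇒ is stub B, ⇐ is convergence). [folklore] -/
theorem lattice_oneSided_iff_limitRatio_le {ρ : ℝ → ℝ} {S : CorrFamily 3}
    (hρ : ∀ δ ∈ Set.Ioc (0:ℝ) 1, 0 < ρ δ)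
    (hlim : HasPointwiseScalingLimit (criticalCorr 3) ρ S) (hnd : IsNondegenerateTwoPoint S)
    {n : ℕ} (hn : Even n) {x : Fin (n + 2) → EuclideanSpace ℝ (Fin 3)}
    (hx : x ∈ NonCoincident 3 (n + 2)) :
    (∀ ε : ℝ, 0 < ε → ∀ᶠ δ in 𝓝[>] (0:ℝ),
        latticeRatio n δ x ≤ latticeRatio n δ (fun i => inversion 0 1 (x i)) + ε) ↔
      limitRatio S n x ≤ limitRatio S n (fun i => inversion 0 1 (x i)) := by
  have hpos := evenPositivity ρ S hρ hlim hnd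
  have hn2 : Even (n + 2) := hn.add even_two
  have hxι : (fun i => inversion (0 : EuclideanSpace ℝ (Fin 3)) 1 (x i)) ∈ NonCoincident 3 (n + 2) :=
    (inversion_injective (0 : EuclideanSpace ℝ (Fin 3)) one_ne_zero).comp hx
  have hSx : S (n + 2) x ≠ 0 := (hpos (n + 2) hn2 x hx).ne'
  have hSxι : S (n + 2) (fun i => inversion 0 1 (x i)) ≠ 0 := (hpos (n + 2) hn2 _ hxι).ne'
  constructor
  · exact ratioTransfer ρ S hρ hlim n x _ hx hxι hSx hSxι
  · intro hle ε hε
    have t1 := tendsto_latticeRatio hρ hlim hx hSx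
    have t2 := tendsto_latticeRatio hρ hlim hxι hSxι
    have t3 : Tendsto (fun δ => latticeRatio n δ (fun i => inversion 0 1 (x i)) + ε - latticeRatio n δ x)
        (𝓝[>] (0:ℝ)) (𝓝 (limitRatio S n (fun i => inversion 0 1 (x i)) + ε - limitRatio S n x)) :=
      (t2.add_const ε).sub t1
    have hgap : 0 < limitRatio S n (fun i => inversion 0 1 (x i)) + ε - limitRatio S n x := by linarith
    filter_upwards [t3.eventually (lt_mem_nhds hgap)] with δ hδ
    linarith

/-- **Stub C is implied by the crux.** [folklore] -/
theorem latticeOneSidedFour_of_crux (hcrux : Crux) : LatticeOneSidedFour := by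
  intro ρ Δ S hρ hlim hnorm hnd heuc hsc x hx hx0 _hx1 ε hε
  have hinv : IsInversionCovariant Δ S := hcrux ρ Δ S hρ hlim hnorm hnd heuc hsc
  exact lattice_oneSided_of_inversionCovariant hρ hlim hnd hinv (n := 2) even_two hx hx0 hε

/-- **Stub D is implied by the crux.** [folklore] -/
theorem latticeOneSidedHigher_of_crux (hcrux : Crux) : LatticeOneSidedHigher := by
  intro ρ Δ S hρ hlim hnorm hnd heuc hsc n hn _h4 x hx hx0 _hx1 ε hε
  have hinv : IsInversionCovariant Δ S := hcrux ρ Δ S hρ hlim hnorm hnd heuc hsc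
  exact lattice_oneSided_of_inversionCovariant hρ hlim hnd hinv hn hx hx0 hε

/-- The ball restriction and the lower bound `4 ≤ n` of stubs C/D are IDLE for necessity: the crux
gives the lattice one-sided inequality at every even `n` and every non-coincident `x` avoiding `0`
(and, applied to `ιx`, the reverse inequality — i.e. the two-sided
`CurrentConnectionInvariance.RatioInversionInvariance` shape). [folklore] -/
theorem lattice_twoSided_of_crux (hcrux : Crux) :
    ∀ (ρ : ℝ → ℝ) (Δ : ℝ) (S : CorrFamily 3), (∀ δ ∈ Set.Ioc (0:ℝ) 1, 0 < ρ δ) →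
      HasPointwiseScalingLimit (criticalCorr 3) ρ S →
      (∀ n z, z ∉ NonCoincident 3 n → S n z = 0) → IsNondegenerateTwoPoint S →
      IsEuclideanInvariant S → IsScaleCovariant Δ S →
      ∀ n : ℕ, Even n → ∀ x : Fin (n + 2) → EuclideanSpace ℝ (Fin 3), x ∈ NonCoincident 3 (n + 2) →
        (∀ i, x i ≠ 0) → ∀ ε : ℝ, 0 < ε → ∀ᶠ δ in 𝓝[>] (0:ℝ),
          latticeRatio n δ x ≤ latticeRatio n δ (fun i => inversion 0 1 (x i)) + ε ∧
          latticeRatio n δ (fun i => inversion 0 1 (x i)) ≤ latticeRatio n δ x + ε := by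
  intro ρ Δ S hρ hlim hnorm hnd heuc hsc n hn x hx hx0 ε hε
  have hinv : IsInversionCovariant Δ S := hcrux ρ Δ S hρ hlim hnorm hnd heuc hsc
  have hxι : (fun i => inversion (0 : EuclideanSpace ℝ (Fin 3)) 1 (x i)) ∈ NonCoincident 3 (n + 2) :=
    (inversion_injective (0 : EuclideanSpace ℝ (Fin 3)) one_ne_zero).comp hx
  have hxι0 : ∀ i, inversion (0 : EuclideanSpace ℝ (Fin 3)) 1 (x i) ≠ 0 := fun i => by
    rw [Ne, inversion_eq_center one_ne_zero]; exact hx0 i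
  have hA := lattice_oneSided_of_inversionCovariant hρ hlim hnd hinv hn hx hx0 hε
  have hB := lattice_oneSided_of_inversionCovariant hρ hlim hnd hinv hn hxι hxι0 hε
  have hιι : (fun i => inversion (0 : EuclideanSpace ℝ (Fin 3)) 1
      (inversion (0 : EuclideanSpace ℝ (Fin 3)) 1 (x i))) = x := by
    funext i; exact inversion_inversion (0 : EuclideanSpace ℝ (Fin 3)) one_ne_zero (x i)
  rw [hιι] at hB
  exact hA.and hB

/-! ### Hypothesis mutation for stub A: non-degeneracy (H4) is load-bearing

The ONLY rigorously available instance of `HasPointwiseScalingLimit (criticalCorr 3) ρ S` is the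
junk one: over-renormalise (`ρ δ = δ`) so that every order `n ≥ 1` is killed.  It satisfies (H1),
(H2), (H3), (H5), (H6) for every `Δ` and the conclusion of the crux (trivially), but violates (H4);
it shows that stub A with `IsNondegenerateTwoPoint` dropped is FALSE (so A is stated with a minimal
hypothesis set; (H1) is sign-only, cf. Disproof §3 `hasPointwiseScalingLimit_abs_iff`). -/

/-- The junk limit `S₀ = (1, 0, 0, …)`. [folklore] -/
def junkLimit : CorrFamily 3 := fun n _ => if n = 0 then 1 else 0

/-- `|⟨∏σ⟩⁺_{β_c}| ≤ 1`. [folklore] -/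
theorem abs_criticalCorr_le_one {n : ℕ} (y : Fin n → Site 3) : |criticalCorr 3 n y| ≤ 1 := by
  classical
  obtain ⟨A, hA⟩ := exists_spinMonomial_eq_spinProduct y
  have h : criticalCorr 3 n y = plusCorr 3 (criticalBeta 3) 0 A := by
    show plusExpect 3 (criticalBeta 3) 0 (spinMonomial y) = _
    rw [hA]; rfl
  rw [h, abs_le]
  exact ⟨by linarith [plusCorr_nonneg (criticalBeta_nonneg 3) le_rfl A],
    plusCorr_le_one (criticalBeta_nonneg 3) le_rfl A⟩

/-- `ρ δ = δ` over-renormalises the critical correlators to the junk limit `S₀`: a genuine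
instance of (H1)+(H2). [folklore] -/
theorem junkLimit_hasPointwiseScalingLimit :
    HasPointwiseScalingLimit (criticalCorr 3) (fun δ => δ) junkLimit := by
  intro n
  apply TendstoUniformlyOn.tendstoLocallyUniformlyOn
  rw [Metric.tendstoUniformlyOn_iff]
  intro ε hε
  rcases Nat.eq_zero_or_pos n with rfl | hn
  · filter_upwards with δ x _
    simp [rescaledCorrelator_apply, junkLimit, criticalCorr_fin_zero, hε]
  · filter_upwards [Ioo_mem_nhdsGT (lt_min zero_lt_one hε)] with δ hδ x _
    have hδ0 : 0 < δ := hδ.1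
    have hδ1 : δ < 1 := lt_of_lt_of_le hδ.2 (min_le_left _ _)
    have hδε : δ < ε := lt_of_lt_of_le hδ.2 (min_le_right _ _)
    have hn0 : n ≠ 0 := hn.ne'
    simp only [junkLimit, if_neg hn0, rescaledCorrelator_apply, Real.dist_eq, zero_sub, abs_neg,
      abs_mul, abs_pow, abs_of_pos hδ0]
    calc δ ^ n * |criticalCorr 3 n fun i => latticeApprox δ (x i)|
        ≤ δ ^ n * 1 :=
          mul_le_mul_of_nonneg_left (abs_criticalCorr_le_one _) (pow_nonneg hδ0.le _)
      _ = δ ^ n := mul_one _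
      _ ≤ δ ^ 1 := pow_le_pow_of_le_one hδ0.le hδ1.le hn
      _ = δ := pow_one _
      _ < ε := hδε

/-- Stub A with the non-degeneracy hypothesis (H4) dropped. [folklore] -/
def EvenPositivityWithoutNondeg : Prop :=
  ∀ (ρ : ℝ → ℝ) (S : CorrFamily 3), (∀ δ ∈ Set.Ioc (0:ℝ) 1, 0 < ρ δ) →
    HasPointwiseScalingLimit (criticalCorr 3) ρ S →
    ∀ n : ℕ, Even n → ∀ x ∈ NonCoincident 3 n, 0 < S n x

/-- **(H4) is load-bearing for stub A**: witness `ρ δ = δ`, `S = S₀`, order `2`,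
configuration `(0, e₀)`. [folklore] -/
theorem not_evenPositivityWithoutNondeg : ¬ EvenPositivityWithoutNondeg := by
  intro h
  have hx : (![0, EuclideanSpace.single 0 1] : Fin 2 → EuclideanSpace ℝ (Fin 3)) ∈
      NonCoincident 3 2 := by
    rw [mem_nonCoincident]
    intro i j hij
    fin_cases i <;> fin_cases j
    · rfl
    · exact absurd hij.symm (by simp)
    · exact absurd hij (by simp)
    · rfl
  have := h (fun δ => δ) junkLimit (fun δ hδ => hδ.1) junkLimit_hasPointwiseScalingLimit 2
    even_two _ hx
  simp [junkLimit] at this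

end Summit.CriticalPhenomena.Ising3DConformalLimit.Cruxes.InversionUpgradeNormalised.Drefute

end
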